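import Literature.LinearAlgebra.Matrix.ModularEuclid
import HarnessLib

/-!
# Deciding solvability of a linear system modulo `N + 1` by diagonalisation (row and column Euclid)

Topic `Literature/LinearAlgebra/Matrix`; sequel of `ModularEuclid.lean` (the two-line engines).
The program `ModDiag.solve N F R P ((c, M), true)` decides whether the system of augmented rows `M`
(lists of residues of length `c + 1`, the last entry the right hand side) has a solution
`x ∈ ℤᶜ` MODULO `N + 1`, by the classical diagonalisation with unimodular operations, every entry
reduced modulo `N + 1` after each operation (the modular technique: numbers never exceed `N`):

* `rowPhase` runs Euclid between the top row and every other row (afterwards column `0` vanishes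
  below the pivot); `colPhase` runs Euclid between column `0` and the columns `1, …, c-1` (never the
  right-hand-side column), keyed by the top row (afterwards the top row vanishes right of the pivot);
  `round = colPhase ∘ rowPhase`; **`round_spec`**: a round either CLEARS the pivot row and column or
  at least HALVES the (positive) pivot, so `R ≥ size N` rounds clear them (`rounds_clear`);
* `peelStep` moves a row with a non-zero coefficient to the top and that coefficient to column `0`,
  runs the rounds, records the solvability condition `gcd(p, N+1) ∣ b` of the decoupled first
  equation `p x₀ ≡ b`, and recurses on the remaining rows with the first column deleted; when all
  coefficients vanish it records `b ≡ 0` for every remaining row;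
* **`solve_eq_true_iff`**: for `F ≥ 2 · size N + 1`, `R ≥ size N`, `P > |M|`,
  `solve N F R P ((c, M), true) = true ↔ Solvable N c M`.

All loops are folds with explicit fuel (the shape a polynomial-time realisation on codes needs:
`Literature/Computability/Complexity/IntegerLinearSolvabilityFP.lean`); everything is proved,
Mathlib only.

## References

* A. Schrijver, *Theory of Linear and Integer Programming*, Wiley 1986, §4.1–§4.4 (unimodular
  transformations, Hermite/Smith normal form decide integer solvability), §5.3 (polynomiality by
  working modulo a subdeterminant) — cited for the method; everything here is proved.
* P. D. Domich, R. Kannan, L. E. Trotter, *Hermite normal form computation using modulo determinant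
  arithmetic*, Math. Oper. Res. 12 (1987) 50–59 — the modular technique.
-/

namespace Literature.LinearAlgebra.Matrix

namespace ModDiag

open Finset

variable (N : ℕ)

/-! ### The row phase -/

/-- One step of the row phase: Euclid between the current top row and the next row; the new top
row is kept, the reduced row is appended to the processed rows. [folklore] -/
def rowStep (F : ℕ) (st : List ℕ × List (List ℕ)) (v : List ℕ) : List ℕ × List (List ℕ) :=
  ((euclid N F (st.1, v)).1, st.2 ++ [(euclid N F (st.1, v)).2])

/-- The ROW PHASE: Euclid between the top row and every other row, in turn. [folklore] -/
def rowPhase (F : ℕ) : List (List ℕ) → List (List ℕ)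
  | [] => []
  | t :: rest => (rest.foldl (rowStep N F) (t, [])).1 :: (rest.foldl (rowStep N F) (t, [])).2

/-! ### The column phase -/

/-- Euclid between column `0` and each column in `js`, in turn. [folklore] -/
def colFold (F : ℕ) (js : List ℕ) (M : List (List ℕ)) : List (List ℕ) :=
  js.foldl (fun M j => ceuclid N F j M) M

/-- The COLUMN PHASE for `c` unknowns: Euclid between column `0` and the columns `1, …, c-1` (never
the right-hand-side column `c`). [folklore] -/
def colPhase (F c : ℕ) (M : List (List ℕ)) : List (List ℕ) := colFold N F (List.range' 1 (c - 1)) M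

/-- One ROUND: the row phase, then the column phase. [folklore] -/
def round (F c : ℕ) (M : List (List ℕ)) : List (List ℕ) := colPhase N F c (rowPhase N F M)

/-- `R` rounds. [folklore] -/
def rounds (F c : ℕ) : ℕ → List (List ℕ) → List (List ℕ)
  | 0, M => M
  | R + 1, M => rounds F c R (round N F c M)

/-- The pivot row and column are CLEAR: column `0` vanishes below the top row and the top row
vanishes at the coefficient columns `1, …, c-1`. [folklore] -/
def Clear (c : ℕ) : List (List ℕ) → Prop
  | [] => True
  | t :: rest => (∀ r ∈ rest, r.getD 0 0 = 0) ∧ ∀ j, 1 ≤ j → j < c → t.getD j 0 = 0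

variable {N}

/-! ### Row phase: invariants -/

section RowPhase

variable {c L F : ℕ}

/-- **The row phase fold with its invariants**: shapes, reducedness, the processed rows have key `0`,
the solution set is preserved, and the pivot stays positive and divides the old pivot. [folklore] -/
theorem rowFold_spec (hL : 0 < L) (hF : 2 * Nat.size N + 1 ≤ F) :
    ∀ (rest : List (List ℕ)) (t : List ℕ) (acc : List (List ℕ)),
      t.length = L → (∀ a ∈ t, a < N + 1) → (∀ r ∈ rest, r.length = L) →
      (∀ r ∈ rest, ∀ a ∈ r, a < N + 1) → 0 < t.getD 0 0 →
      (rest.foldl (rowStep N F) (t, acc)).1.length = L ∧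
      (∀ a ∈ (rest.foldl (rowStep N F) (t, acc)).1, a < N + 1) ∧
      0 < (rest.foldl (rowStep N F) (t, acc)).1.getD 0 0 ∧
      (rest.foldl (rowStep N F) (t, acc)).1.getD 0 0 ∣ t.getD 0 0 ∧
      ∃ new : List (List ℕ), (rest.foldl (rowStep N F) (t, acc)).2 = acc ++ new ∧
        new.length = rest.length ∧ (∀ r ∈ new, r.length = L) ∧ (∀ r ∈ new, ∀ a ∈ r, a < N + 1) ∧
        (∀ r ∈ new, r.getD 0 0 = 0) ∧
        ∀ x : ℕ → ℤ, (Sat N c x (rest.foldl (rowStep N F) (t, acc)).1 ∧ ∀ r ∈ new, Sat N c x r) ↔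
          (Sat N c x t ∧ ∀ r ∈ rest, Sat N c x r) := by
  intro rest
  induction rest with
  | nil =>
    intro t acc htl htr _ _ hpos
    refine ⟨htl, htr, hpos, dvd_rfl, [], by simp, rfl, by simp, by simp, by simp, fun x => by simp⟩
  | cons v rest ih =>
    intro t acc htl htr hrl hrr hpos
    rw [List.foldl_cons]
    have hvl : v.length = L := hrl v List.mem_cons_self
    have hvr : ∀ a ∈ v, a < N + 1 := hrr v List.mem_cons_self
    have hok : PairOK N L (t, v) := ⟨htl, hvl, htr, hvr⟩
    set e := euclid N F (t, v) with he
    have hoke : PairOK N L e := pairOK_euclid F hok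
    have hkeys : keys e = (Nat.gcd (t.getD 0 0) (v.getD 0 0), 0) := by
      rw [he, keys_euclid F hok hL]
      exact kiter_spec hpos (Nat.lt_succ_iff.1 (getD_lt_of_reduced htr 0)) hF
    have hk1 : e.1.getD 0 0 = Nat.gcd (t.getD 0 0) (v.getD 0 0) := congrArg Prod.fst hkeys
    have hk2 : e.2.getD 0 0 = 0 := congrArg Prod.snd hkeys
    have hpos' : 0 < e.1.getD 0 0 := by rw [hk1]; exact Nat.gcd_pos_of_pos_left _ hpos
    have hstep : rowStep N F (t, acc) v = (e.1, acc ++ [e.2]) := rfl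
    rw [hstep]
    obtain ⟨h1, h2, h3, h4, new, h5, h6, h7, h8, h9, h10⟩ :=
      ih e.1 (acc ++ [e.2]) hoke.1 hoke.2.2.1 (fun r hr => hrl r (List.mem_cons_of_mem v hr))
        (fun r hr => hrr r (List.mem_cons_of_mem v hr)) hpos'
    refine ⟨h1, h2, h3, h4.trans (hk1 ▸ Nat.gcd_dvd_left _ _), e.2 :: new, by simp [h5], by simp [h6], ?_, ?_, ?_, ?_⟩
    · intro r hr
      rcases List.mem_cons.1 hr with rfl | hr
      · exact hoke.2.1
      · exact h7 r hr
    · intro r hr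
      rcases List.mem_cons.1 hr with rfl | hr
      · exact hoke.2.2.2
      · exact h8 r hr
    · intro r hr
      rcases List.mem_cons.1 hr with rfl | hr
      · exact hk2
      · exact h9 r hr
    · intro x
      have hse := sat_euclid_iff (c := c) (x := x) F hok
      rw [← he] at hse
      simp only [List.mem_cons, forall_eq_or_imp]
      constructor
      · rintro ⟨ho, he2, hnew⟩
        obtain ⟨he1, hrest⟩ := (h10 x).1 ⟨ho, hnew⟩
        obtain ⟨ht, hv⟩ := hse.1 ⟨he1, he2⟩
        exact ⟨ht, hv, hrest⟩
      · rintro ⟨ht, hv, hrest⟩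
        obtain ⟨he1, he2⟩ := hse.2 ⟨ht, hv⟩
        obtain ⟨ho, hnew⟩ := (h10 x).2 ⟨he1, hrest⟩
        exact ⟨ho, he2, hnew⟩

/-- If every other row already has key `0`, the row phase fold changes nothing. [folklore] -/
theorem rowFold_of_clear (F : ℕ) :
    ∀ (rest : List (List ℕ)) (t : List ℕ) (acc : List (List ℕ)), (∀ r ∈ rest, r.getD 0 0 = 0) →
      rest.foldl (rowStep N F) (t, acc) = (t, acc ++ rest) := by
  intro rest
  induction rest with
  | nil => intro t acc _; simp
  | cons v rest ih =>
    intro t acc h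
    rw [List.foldl_cons]
    have hv : euclid N F (t, v) = (t, v) := euclid_of_key_eq_zero F (h v List.mem_cons_self)
    have hstep : rowStep N F (t, acc) v = (t, acc ++ [v]) := by
      simp only [rowStep, hv]
    rw [hstep, ih t (acc ++ [v]) (fun r hr => h r (List.mem_cons_of_mem v hr))]
    simp

/-- **The row phase on a well-formed reduced system with positive pivot**: shape, reducedness,
solution set, cleared column `0`, positive pivot dividing the old one. [folklore] -/
theorem rowPhase_spec (hF : 2 * Nat.size N + 1 ≤ F) {t : List ℕ} {rest : List (List ℕ)}
    (hwf : WF c (t :: rest)) (hred : Reduced N (t :: rest)) (hpos : 0 < t.getD 0 0) :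
    ∃ t' rest', rowPhase N F (t :: rest) = t' :: rest' ∧ WF c (t' :: rest') ∧ Reduced N (t' :: rest') ∧
      rest'.length = rest.length ∧ (∀ r ∈ rest', r.getD 0 0 = 0) ∧ 0 < t'.getD 0 0 ∧
      t'.getD 0 0 ∣ t.getD 0 0 ∧
      ∀ x : ℕ → ℤ, (∀ r ∈ t' :: rest', Sat N c x r) ↔ ∀ r ∈ t :: rest, Sat N c x r := by
  obtain ⟨h1, h2, h3, h4, new, h5, h6, h7, h8, h9, h10⟩ :=
    rowFold_spec (c := c) (acc := []) (Nat.succ_pos c) hF rest t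
      (hwf t List.mem_cons_self) (hred t List.mem_cons_self)
      (fun r hr => hwf r (List.mem_cons_of_mem t hr)) (fun r hr => hred r (List.mem_cons_of_mem t hr)) hpos
  rw [List.nil_append] at h5
  refine ⟨_, new, by rw [rowPhase, h5], ?_, ?_, h6, h9, h3, h4, fun x => ?_⟩
  · intro r hr
    rcases List.mem_cons.1 hr with rfl | hr
    · exact h1
    · exact h7 r hr
  · intro r hr
    rcases List.mem_cons.1 hr with rfl | hr
    · exact h2
    · exact h8 r hr
  · simp only [List.mem_cons, forall_eq_or_imp]
    exact h10 x

/-- If column `0` is already clear below the top, the row phase changes nothing. [folklore] -/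
theorem rowPhase_of_clear (F : ℕ) {t : List ℕ} {rest : List (List ℕ)} (h : ∀ r ∈ rest, r.getD 0 0 = 0) :
    rowPhase N F (t :: rest) = t :: rest := by
  rw [rowPhase, rowFold_of_clear F rest t [] h]
  simp

end RowPhase

/-! ### Column phase: invariants -/

section ColPhase

variable {c F : ℕ}

/-- `cstep` changes no top entry outside columns `0` and `j` (for `j` inside the top row).
[folklore] -/
theorem cstep_head_getD_of_ne {j i : ℕ} {t : List ℕ} {M : List (List ℕ)} (hjl : j < t.length)
    (hi0 : i ≠ 0) (hij : i ≠ j) :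
    ∃ t' M', cstep N j (t :: M) = t' :: M' ∧ t'.getD i 0 = t.getD i 0 ∧ t'.length = t.length := by
  rcases cstep_cases (N := N) j (t :: M) with e | ⟨q, e⟩ | ⟨q, e⟩ <;> rw [e]
  · exact ⟨t, M, rfl, rfl, rfl⟩
  · refine ⟨_, _, rfl, ?_, by simp⟩
    rw [getD_colOp, if_neg (fun h => hij h.1)]
  · refine ⟨_, _, rfl, ?_, by simp⟩
    have hjl' : j < (colOp N j q t).length := by simpa using hjl
    rw [getD_swapCols hjl', Equiv.swap_apply_of_ne_of_ne hi0 hij, getD_colOp, if_neg (fun h => hij h.1)]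

/-- `ceuclid` changes no top entry outside columns `0` and `j`. [folklore] -/
theorem ceuclid_head_getD_of_ne {j i : ℕ} (F : ℕ) :
    ∀ {t : List ℕ} {M : List (List ℕ)}, j < t.length → i ≠ 0 → i ≠ j →
      ∃ t' M', ceuclid N F j (t :: M) = t' :: M' ∧ t'.getD i 0 = t.getD i 0 := by
  induction F with
  | zero => intro t M _ _ _; exact ⟨t, M, rfl, rfl⟩
  | succ F ih =>
    intro t M hjl hi0 hij
    obtain ⟨t₁, M₁, he, hget, hlen⟩ := cstep_head_getD_of_ne (N := N) (M := M) hjl hi0 hij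
    rw [ceuclid, he]
    obtain ⟨t', M', he', hget'⟩ := ih (t := t₁) (M := M₁) (hlen ▸ hjl) hi0 hij
    exact ⟨t', M', he', hget'.trans hget⟩

/-- Column `0` of every row is untouched by a column transvection. [folklore] -/
theorem map_key_map_colOp {j q : ℕ} (hj : j ≠ 0) (M : List (List ℕ)) :
    (M.map (colOp N j q)).map (fun r => r.getD 0 0) = M.map (fun r => r.getD 0 0) := by
  rw [List.map_map]
  refine List.map_congr_left fun r _ => ?_
  exact getD_colOp_zero r hj

/-- **Euclid on columns `0`, `j` with its invariants**: shape, reducedness, solvability, the new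
pivot is positive and divides the old one, `t[j]` vanishes, other top entries are untouched, and
either column `0` of every row is untouched or the pivot at least halves. [folklore] -/
theorem ceuclid_spec (hF : 2 * Nat.size N + 1 ≤ F) {j : ℕ} (hj1 : 1 ≤ j) (hjc : j < c) {t : List ℕ}
    {rest : List (List ℕ)} (hwf : WF c (t :: rest)) (hred : Reduced N (t :: rest)) (hpos : 0 < t.getD 0 0) :
    ∃ t' rest', ceuclid N F j (t :: rest) = t' :: rest' ∧ WF c (t' :: rest') ∧ Reduced N (t' :: rest') ∧
      rest'.length = rest.length ∧ (Solvable N c (t' :: rest') ↔ Solvable N c (t :: rest)) ∧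
      0 < t'.getD 0 0 ∧ t'.getD 0 0 ∣ t.getD 0 0 ∧ t'.getD j 0 = 0 ∧
      (∀ i, i ≠ 0 → i ≠ j → t'.getD i 0 = t.getD i 0) ∧
      ((t' :: rest').map (fun r => r.getD 0 0) = (t :: rest).map (fun r => r.getD 0 0) ∨
        2 * t'.getD 0 0 ≤ t.getD 0 0) := by
  obtain ⟨hwf', hred', hlen, hsol⟩ := ceuclid_invariants (N := N) F hwf hred hj1 hjc
  have htl : t.length = c + 1 := hwf t List.mem_cons_self
  have hjl : j < t.length := by omega
  have htr : ∀ a ∈ t, a < N + 1 := hred t List.mem_cons_self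
  -- shape
  obtain ⟨t', rest', he⟩ : ∃ t' rest', ceuclid N F j (t :: rest) = t' :: rest' := by
    cases h : ceuclid N F j (t :: rest) with
    | nil => rw [h] at hlen; simp at hlen
    | cons t' rest' => exact ⟨t', rest', rfl⟩
  rw [he] at hwf' hred' hlen hsol
  -- keys
  have hkeys : ckeys j (t' :: rest') = (Nat.gcd (t.getD 0 0) (t.getD j 0), 0) := by
    rw [← he, ckeys_ceuclid F hred hwf hj1 (by omega)]
    exact kiter_spec hpos (Nat.lt_succ_iff.1 (getD_lt_of_reduced htr 0)) hF
  have hk1 : t'.getD 0 0 = Nat.gcd (t.getD 0 0) (t.getD j 0) := congrArg Prod.fst hkeys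
  have hk2 : t'.getD j 0 = 0 := congrArg Prod.snd hkeys
  refine ⟨t', rest', he, hwf', hred', by simpa using hlen, hsol, ?_, ?_, hk2, ?_, ?_⟩
  · rw [hk1]; exact Nat.gcd_pos_of_pos_left _ hpos
  · rw [hk1]; exact Nat.gcd_dvd_left _ _
  · intro i hi0 hij
    obtain ⟨t'', M'', he'', hget⟩ := ceuclid_head_getD_of_ne (N := N) F (t := t) (M := rest) hjl hi0 hij
    rw [he] at he''
    obtain ⟨rfl, -⟩ := List.cons.inj he''
    exact hget
  · by_cases hd : t.getD 0 0 ∣ t.getD j 0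
    · left
      rcases ceuclid_of_dvd (N := N) F (M := rest) htr hj1 hjl hd (by omega) with e | e
      · rw [← he, e]; exact map_key_map_colOp (by omega) _
      · rw [← he, e]
    · right
      rw [hk1]
      have := two_mul_kiter_fst_le (F := F) hpos (Nat.lt_succ_iff.1 (getD_lt_of_reduced htr 0)) hF hd
      rwa [kiter_spec hpos (Nat.lt_succ_iff.1 (getD_lt_of_reduced htr 0)) hF] at this

/-- **The column fold with its invariants** (all `j ∈ js` with `1 ≤ j < c`). [folklore] -/
theorem colFold_spec (hF : 2 * Nat.size N + 1 ≤ F) :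
    ∀ (js : List ℕ) (t : List ℕ) (rest : List (List ℕ)), (∀ j ∈ js, 1 ≤ j ∧ j < c) →
      WF c (t :: rest) → Reduced N (t :: rest) → 0 < t.getD 0 0 →
      ∃ t' rest', colFold N F js (t :: rest) = t' :: rest' ∧ WF c (t' :: rest') ∧ Reduced N (t' :: rest') ∧
        rest'.length = rest.length ∧ (Solvable N c (t' :: rest') ↔ Solvable N c (t :: rest)) ∧
        0 < t'.getD 0 0 ∧ t'.getD 0 0 ∣ t.getD 0 0 ∧
        (∀ j ∈ js, t'.getD j 0 = 0) ∧
        (∀ i, i ≠ 0 → i ∉ js → t'.getD i 0 = t.getD i 0) ∧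
        ((t' :: rest').map (fun r => r.getD 0 0) = (t :: rest).map (fun r => r.getD 0 0) ∨
          2 * t'.getD 0 0 ≤ t.getD 0 0) := by
  intro js
  induction js with
  | nil =>
    intro t rest _ hwf hred hpos
    exact ⟨t, rest, rfl, hwf, hred, rfl, Iff.rfl, hpos, dvd_rfl, by simp, fun _ _ _ => rfl, Or.inl rfl⟩
  | cons j js ih =>
    intro t rest hjs hwf hred hpos
    obtain ⟨hj1, hjc⟩ := hjs j List.mem_cons_self
    obtain ⟨t₁, rest₁, he₁, hwf₁, hred₁, hlen₁, hsol₁, hpos₁, hdvd₁, hkj₁, hoth₁, hdich₁⟩ :=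
      ceuclid_spec (N := N) hF hj1 hjc hwf hred hpos
    obtain ⟨t', rest', he', hwf', hred', hlen', hsol', hpos', hdvd', hcl', hoth', hdich'⟩ :=
      ih t₁ rest₁ (fun j' hj' => hjs j' (List.mem_cons_of_mem j hj')) hwf₁ hred₁ hpos₁
    have hfold : colFold N F (j :: js) (t :: rest) = colFold N F js (t₁ :: rest₁) := by
      rw [colFold, List.foldl_cons, ← he₁]; rfl
    refine ⟨t', rest', hfold.trans he', hwf', hred', hlen'.trans hlen₁, hsol'.trans hsol₁, hpos',
      hdvd'.trans hdvd₁, ?_, ?_, ?_⟩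
    · intro j' hj'
      rcases List.mem_cons.1 hj' with rfl | hj'
      · by_cases hmem : j' ∈ js
        · exact hcl' j' hmem
        · rw [hoth' j' (by omega) hmem]; exact hkj₁
      · exact hcl' j' hj'
    · intro i hi0 hi
      rw [List.mem_cons, not_or] at hi
      rw [hoth' i hi0 hi.2, hoth₁ i hi0 hi.1]
    · have hle₁ : t₁.getD 0 0 ≤ t.getD 0 0 := Nat.le_of_dvd hpos hdvd₁
      rcases hdich' with hsame' | hhalf'
      · rcases hdich₁ with hsame₁ | hhalf₁
        · exact Or.inl (hsame'.trans hsame₁)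
        · right
          have hhead : t'.getD 0 0 = t₁.getD 0 0 := by
            have := congrArg List.head? hsame'
            simpa using this
          rw [hhead]; exact hhalf₁
      · right; omega

/-- If the top row is already clear at every `j ∈ js`, the column fold changes nothing. [folklore] -/
theorem colFold_of_clear (F : ℕ) :
    ∀ (js : List ℕ) (t : List ℕ) (rest : List (List ℕ)), (∀ j ∈ js, t.getD j 0 = 0) →
      colFold N F js (t :: rest) = t :: rest := by
  intro js
  induction js with
  | nil => intro t rest _; rfl
  | cons j js ih =>
    intro t rest h
    rw [colFold, List.foldl_cons, ceuclid_of_key_eq_zero F (by simpa using h j List.mem_cons_self)]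
    exact ih t rest (fun j' hj' => h j' (List.mem_cons_of_mem j hj'))

/-- The columns treated by the column phase are `1, …, c-1`. [folklore] -/
theorem mem_range'_iff {c j : ℕ} : j ∈ List.range' 1 (c - 1) ↔ 1 ≤ j ∧ j < c := by
  rw [List.mem_range'_1]; omega

end ColPhase

/-! ### Rounds -/

section Rounds

variable {c F : ℕ}

/-- A clear system is fixed by a round. [folklore] -/
theorem round_of_clear (F : ℕ) {t : List ℕ} {rest : List (List ℕ)} (h : Clear c (t :: rest)) :
    round N F c (t :: rest) = t :: rest := by
  rw [round, rowPhase_of_clear F h.1, colPhase]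
  exact colFold_of_clear F _ t rest (fun j hj => h.2 j (mem_range'_iff.1 hj).1 (mem_range'_iff.1 hj).2)

/-- A clear system is fixed by the rounds. [folklore] -/
theorem rounds_of_clear (F : ℕ) {t : List ℕ} {rest : List (List ℕ)} (h : Clear c (t :: rest)) (R : ℕ) :
    rounds N F c R (t :: rest) = t :: rest := by
  induction R with
  | zero => rfl
  | succ R ih => rw [rounds, round_of_clear F h, ih]

/-- **One round**: shape, reducedness, solvability and positivity of the pivot are kept, and the
result is CLEAR or its pivot is at most half the old pivot. [folklore] -/
theorem round_spec (hF : 2 * Nat.size N + 1 ≤ F) {t : List ℕ} {rest : List (List ℕ)}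
    (hwf : WF c (t :: rest)) (hred : Reduced N (t :: rest)) (hpos : 0 < t.getD 0 0) :
    ∃ t' rest', round N F c (t :: rest) = t' :: rest' ∧ WF c (t' :: rest') ∧ Reduced N (t' :: rest') ∧
      rest'.length = rest.length ∧ (Solvable N c (t' :: rest') ↔ Solvable N c (t :: rest)) ∧
      0 < t'.getD 0 0 ∧ (Clear c (t' :: rest') ∨ 2 * t'.getD 0 0 ≤ t.getD 0 0) := by
  obtain ⟨t₁, rest₁, he₁, hwf₁, hred₁, hlen₁, hclear₁, hpos₁, hdvd₁, hsat₁⟩ := rowPhase_spec (c := c) hF hwf hred hpos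
  obtain ⟨t', rest', he', hwf', hred', hlen', hsol', hpos', hdvd', hcl', -, hdich'⟩ :=
    colFold_spec (N := N) (c := c) hF (List.range' 1 (c - 1)) t₁ rest₁ (fun j hj => mem_range'_iff.1 hj) hwf₁ hred₁ hpos₁
  have hsol₁ : Solvable N c (t₁ :: rest₁) ↔ Solvable N c (t :: rest) :=
    ⟨fun ⟨x, hx⟩ => ⟨x, (hsat₁ x).1 hx⟩, fun ⟨x, hx⟩ => ⟨x, (hsat₁ x).2 hx⟩⟩
  refine ⟨t', rest', by rw [round, he₁, colPhase, he'], hwf', hred', hlen'.trans hlen₁, hsol'.trans hsol₁, hpos', ?_⟩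
  rcases hdich' with hsame | hhalf
  · left
    refine ⟨?_, fun j hj1 hjc => hcl' j (mem_range'_iff.2 ⟨hj1, hjc⟩)⟩
    have hkeys : rest'.map (fun r => r.getD 0 0) = rest₁.map (fun r => r.getD 0 0) := by
      have := congrArg List.tail hsame
      simpa using this
    intro r hr
    have hmem : r.getD 0 0 ∈ rest₁.map (fun r => r.getD 0 0) := by
      rw [← hkeys]; exact List.mem_map_of_mem hr
    obtain ⟨r₁, hr₁, hr₁e⟩ := List.mem_map.1 hmem
    rw [← hr₁e]; exact hclear₁ r₁ hr₁
  · right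
    have hle₁ : t₁.getD 0 0 ≤ t.getD 0 0 := Nat.le_of_dvd hpos hdvd₁
    omega

/-- **The rounds**: invariants, and CLEAR or the pivot shrank by `2^R`. [folklore] -/
theorem rounds_spec (hF : 2 * Nat.size N + 1 ≤ F) :
    ∀ (R : ℕ) (t : List ℕ) (rest : List (List ℕ)), WF c (t :: rest) → Reduced N (t :: rest) → 0 < t.getD 0 0 →
      ∃ t' rest', rounds N F c R (t :: rest) = t' :: rest' ∧ WF c (t' :: rest') ∧ Reduced N (t' :: rest') ∧
        rest'.length = rest.length ∧ (Solvable N c (t' :: rest') ↔ Solvable N c (t :: rest)) ∧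
        0 < t'.getD 0 0 ∧ (Clear c (t' :: rest') ∨ 2 ^ R * t'.getD 0 0 ≤ t.getD 0 0) := by
  intro R
  induction R with
  | zero =>
    intro t rest hwf hred hpos
    exact ⟨t, rest, rfl, hwf, hred, rfl, Iff.rfl, hpos, Or.inr (by simp)⟩
  | succ R ih =>
    intro t rest hwf hred hpos
    obtain ⟨t₁, rest₁, he₁, hwf₁, hred₁, hlen₁, hsol₁, hpos₁, hdich₁⟩ := round_spec (N := N) hF hwf hred hpos
    rw [rounds, he₁]
    rcases hdich₁ with hclear | hhalf
    · refine ⟨t₁, rest₁, rounds_of_clear F hclear R, hwf₁, hred₁, hlen₁, hsol₁, hpos₁, Or.inl hclear⟩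
    · obtain ⟨t', rest', he', hwf', hred', hlen', hsol', hpos', hdich'⟩ := ih t₁ rest₁ hwf₁ hred₁ hpos₁
      refine ⟨t', rest', he', hwf', hred', hlen'.trans hlen₁, hsol'.trans hsol₁, hpos', ?_⟩
      rcases hdich' with hclear' | hhalf'
      · exact Or.inl hclear'
      · right
        rw [pow_succ]
        calc 2 ^ R * 2 * t'.getD 0 0 = 2 * (2 ^ R * t'.getD 0 0) := by ring
          _ ≤ 2 * t₁.getD 0 0 := Nat.mul_le_mul_left 2 hhalf'
          _ ≤ t.getD 0 0 := hhalf

/-- **`size N` rounds clear the pivot row and column.** [folklore] -/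
theorem rounds_clear (hF : 2 * Nat.size N + 1 ≤ F) {R : ℕ} (hR : Nat.size N ≤ R) {t : List ℕ}
    {rest : List (List ℕ)} (hwf : WF c (t :: rest)) (hred : Reduced N (t :: rest)) (hpos : 0 < t.getD 0 0) :
    ∃ t' rest', rounds N F c R (t :: rest) = t' :: rest' ∧ WF c (t' :: rest') ∧ Reduced N (t' :: rest') ∧
      rest'.length = rest.length ∧ (Solvable N c (t' :: rest') ↔ Solvable N c (t :: rest)) ∧
      0 < t'.getD 0 0 ∧ Clear c (t' :: rest') := by
  obtain ⟨t', rest', he, hwf', hred', hlen, hsol, hpos', hdich⟩ := rounds_spec (N := N) (c := c) hF R t rest hwf hred hpos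
  refine ⟨t', rest', he, hwf', hred', hlen, hsol, hpos', hdich.resolve_right fun hle => ?_⟩
  have htN : t.getD 0 0 < 2 ^ R :=
    lt_of_lt_of_le (lt_of_lt_of_le (getD_lt_of_reduced (hred t List.mem_cons_self) 0) (Nat.lt_size_self _))
      (Nat.pow_le_pow_right (by norm_num) hR)
  have : 2 ^ R * 1 ≤ 2 ^ R * t'.getD 0 0 := Nat.mul_le_mul_left _ hpos'
  omega

end Rounds

/-! ### Reading off solvability -/

section ReadOff

variable {c : ℕ}

/-- A residue divisible by the modulus is `0`. [folklore] -/
theorem eq_zero_of_modEq_zero {b : ℕ} (hb : b < N + 1) (h : (0 : ℤ) ≡ (b : ℤ) [ZMOD ((N : ℤ) + 1)]) : b = 0 := by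
  have hd : ((N : ℤ) + 1) ∣ (b : ℤ) := by
    have := (Int.modEq_iff_dvd.1 h); simpa using this
  have hd' : (N + 1) ∣ b := by exact_mod_cast hd
  exact Nat.eq_zero_of_dvd_of_lt hd' hb

/-- **Rows without coefficients**: a reduced system all of whose coefficients vanish is solvable iff
all its right hand sides vanish. [folklore] -/
theorem solvable_iff_of_coeffs_zero {M : List (List ℕ)} (hz : ∀ r ∈ M, ∀ i, i < c → r.getD i 0 = 0)
    (hred : Reduced N M) : Solvable N c M ↔ ∀ r ∈ M, r.getD c 0 = 0 := by
  have hsat : ∀ (x : ℕ → ℤ) (r : List ℕ), r ∈ M → (Sat N c x r ↔ r.getD c 0 = 0) := by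
    intro x r hr
    unfold Sat
    have h0 : (∑ i : Fin c, ent r i * x i) = 0 :=
      Finset.sum_eq_zero fun i _ => by unfold ent; rw [hz r hr i i.isLt]; simp
    rw [h0]
    constructor
    · intro h; exact eq_zero_of_modEq_zero (getD_lt_of_reduced (hred r hr) c) h
    · intro h; unfold ent; rw [h, Nat.cast_zero]
  constructor
  · rintro ⟨x, hx⟩ r hr; exact (hsat x r hr).1 (hx r hr)
  · intro h; exact ⟨fun _ => 0, fun r hr => (hsat _ r hr).2 (h r hr)⟩

/-- Prepending a value to a sequence of unknowns. [folklore] -/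
def consSeq (x₀ : ℤ) (x : ℕ → ℤ) : ℕ → ℤ
  | 0 => x₀
  | i + 1 => x i

/-- Entries of the tail. [folklore] -/
theorem getD_tail (r : List ℕ) (i : ℕ) : r.tail.getD i 0 = r.getD (i + 1) 0 := by
  cases r <;> simp

/-- **Decoupling a clear system**: with the pivot row and column clear, the system holds iff the
first equation `p x₀ ≡ b` is solvable and the remaining rows, first column deleted, are solvable in
the remaining unknowns. [folklore] -/
theorem solvable_clear_iff {t : List ℕ} {rest : List (List ℕ)} (hc : 1 ≤ c) (hwf : WF c (t :: rest))
    (hclear : Clear c (t :: rest)) :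
    Solvable N c (t :: rest) ↔
      (∃ x₀ : ℤ, (t.getD 0 0 : ℤ) * x₀ ≡ ent t c [ZMOD ((N : ℤ) + 1)]) ∧
        Solvable N (c - 1) (rest.map List.tail) := by
  obtain ⟨c', rfl⟩ : ∃ c', c = c' + 1 := ⟨c - 1, by omega⟩
  simp only [Nat.add_sub_cancel]
  obtain ⟨hcol, htop⟩ := hclear
  -- the top equation only involves `x 0`
  have htopSat : ∀ x : ℕ → ℤ, Sat N (c' + 1) x t ↔ (t.getD 0 0 : ℤ) * x 0 ≡ ent t (c' + 1) [ZMOD ((N : ℤ) + 1)] := by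
    intro x
    unfold Sat
    rw [Fin.sum_univ_succ]
    have hz : ∑ i : Fin c', ent t (i.succ : Fin (c' + 1)) * x (i.succ : Fin (c' + 1)) = 0 :=
      Finset.sum_eq_zero fun i _ => by
        unfold ent
        rw [Fin.val_succ, htop (i + 1) (by omega) (by omega)]
        simp
    rw [hz, add_zero]
    rfl
  -- the other equations only involve `x 1, x 2, …`
  have hrestSat : ∀ (x : ℕ → ℤ) (r : List ℕ), r ∈ rest →
      (Sat N (c' + 1) x r ↔ Sat N c' (fun i => x (i + 1)) r.tail) := by
    intro x r hr
    unfold Sat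
    rw [Fin.sum_univ_succ]
    have h0 : ent r ((0 : Fin (c' + 1)) : ℕ) * x ((0 : Fin (c' + 1)) : ℕ) = 0 := by
      unfold ent; rw [Fin.val_zero, hcol r hr]; simp
    rw [h0, zero_add]
    have h1 : ∀ i : Fin c', ent r ((i.succ : Fin (c' + 1)) : ℕ) * x ((i.succ : Fin (c' + 1)) : ℕ) =
        ent r.tail i * x (i + 1) := fun i => by
      unfold ent; rw [Fin.val_succ, getD_tail]
    have h2 : ent r (c' + 1) = ent r.tail c' := by unfold ent; rw [getD_tail]
    simp_rw [h1, h2]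
  constructor
  · rintro ⟨x, hx⟩
    refine ⟨⟨x 0, (htopSat x).1 (hx t List.mem_cons_self)⟩, fun i => x (i + 1), fun r hr => ?_⟩
    obtain ⟨r', hr', rfl⟩ := List.mem_map.1 hr
    exact (hrestSat x r' hr').1 (hx r' (List.mem_cons_of_mem t hr'))
  · rintro ⟨⟨x₀, hx₀⟩, x, hx⟩
    refine ⟨consSeq x₀ x, fun r hr => ?_⟩
    rcases List.mem_cons.1 hr with rfl | hr
    · exact (htopSat _).2 hx₀
    · rw [hrestSat _ r hr]
      exact hx r.tail (List.mem_map_of_mem hr)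

/-- **The linear congruence `p x ≡ b (mod m)` is solvable iff `gcd(p, m) ∣ b`** (`m = N + 1`).
[folklore] -/
theorem exists_mul_modEq_iff (p b : ℕ) :
    (∃ x₀ : ℤ, (p : ℤ) * x₀ ≡ (b : ℤ) [ZMOD ((N : ℤ) + 1)]) ↔ b % Nat.gcd p (N + 1) = 0 := by
  have hm : ((N + 1 : ℕ) : ℤ) = (N : ℤ) + 1 := by push_cast; ring
  constructor
  · rintro ⟨x₀, hx⟩
    apply Nat.mod_eq_zero_of_dvd
    have h1 : (Nat.gcd p (N + 1) : ℤ) ∣ (p : ℤ) * x₀ :=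
      Dvd.dvd.mul_right (Int.natCast_dvd_natCast.2 (Nat.gcd_dvd_left _ _)) _
    have h2 : (Nat.gcd p (N + 1) : ℤ) ∣ (N : ℤ) + 1 := by
      rw [← hm]; exact Int.natCast_dvd_natCast.2 (Nat.gcd_dvd_right _ _)
    have h3 : ((N : ℤ) + 1) ∣ (b : ℤ) - (p : ℤ) * x₀ := Int.modEq_iff_dvd.1 hx
    have h4 : (Nat.gcd p (N + 1) : ℤ) ∣ (b : ℤ) := by
      have := (h2.trans h3).add h1
      simpa using this
    exact Int.natCast_dvd_natCast.1 h4
  · intro h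
    obtain ⟨k, hk⟩ := Nat.dvd_of_mod_eq_zero h
    refine ⟨Nat.gcdA p (N + 1) * k, ?_⟩
    have hB := Int.gcd_a_modEq p (N + 1)
    rw [hm] at hB
    have := hB.mul_right (k : ℤ)
    rw [← mul_assoc]
    refine this.trans ?_
    rw [hk]; push_cast; exact Int.ModEq.refl _

end ReadOff

/-! ### Pivot search -/

section Pivot

/-- Index of the first non-zero entry. [folklore] -/
def firstNZ : List ℕ → Option ℕ
  | [] => none
  | a :: l => if a = 0 then (firstNZ l).map Nat.succ else some 0

/-- `firstNZ = none`: all entries vanish. [folklore] -/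
theorem firstNZ_eq_none {l : List ℕ} (h : firstNZ l = none) : ∀ a ∈ l, a = 0 := by
  induction l with
  | nil => simp
  | cons b l ih =>
    intro a ha
    unfold firstNZ at h
    split_ifs at h with hb
    · rcases List.mem_cons.1 ha with rfl | ha
      · exact hb
      · exact ih (by cases h' : firstNZ l with | none => rfl | some j => rw [h'] at h; simp at h) a ha

/-- `firstNZ = some j`: entry `j` exists and is non-zero. [folklore] -/
theorem firstNZ_eq_some {l : List ℕ} {j : ℕ} (h : firstNZ l = some j) : j < l.length ∧ l.getD j 0 ≠ 0 := by
  induction l generalizing j with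
  | nil => simp [firstNZ] at h
  | cons b l ih =>
    unfold firstNZ at h
    split_ifs at h with hb
    · cases h' : firstNZ l with
      | none => rw [h'] at h; simp at h
      | some j' =>
        rw [h'] at h
        simp only [Option.map_some, Option.some.injEq] at h
        subst h
        obtain ⟨h1, h2⟩ := ih h'
        exact ⟨by simpa using h1, by simpa using h2⟩
    · simp only [Option.some.injEq] at h
      subst h
      exact ⟨by simp, by simpa using hb⟩

variable (c : ℕ)

/-- Find a row with a non-zero COEFFICIENT (index `< c`) and bring it to the front: returns that
row, the index of its first non-zero coefficient, and the other rows (in order). [folklore] -/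
def splitPivot : List (List ℕ) → Option (List ℕ × ℕ × List (List ℕ))
  | [] => none
  | r :: M =>
    match firstNZ (r.take c) with
    | some j => some (r, j, M)
    | none => (splitPivot M).map fun p => (p.1, p.2.1, r :: p.2.2)

variable {c}

/-- `splitPivot = none`: every coefficient of every row vanishes. [folklore] -/
theorem splitPivot_eq_none {M : List (List ℕ)} (h : splitPivot c M = none) :
    ∀ r ∈ M, ∀ i, i < c → r.getD i 0 = 0 := by
  induction M with
  | nil => simp
  | cons r M ih =>
    intro r' hr' i hi
    unfold splitPivot at h
    cases hf : firstNZ (r.take c) with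
    | some j => rw [hf] at h; simp at h
    | none =>
      rw [hf] at h
      simp only [Option.map_eq_none_iff] at h
      rcases List.mem_cons.1 hr' with rfl | hr'
      · have hz := firstNZ_eq_none hf
        by_cases hil : i < r'.length
        · have hmem : r'.getD i 0 ∈ r'.take c := by
            rw [List.getD_eq_getElem?_getD, List.getElem?_eq_getElem hil]
            exact List.mem_take_iff_getElem.2 ⟨i, by simp [hi, hil], rfl⟩
          exact hz _ hmem
        · exact getD_of_le (not_lt.1 hil)
      · exact ih h r' hr' i hi

/-- `splitPivot = some (r, j, M')`: `r :: M'` has the same members as `M`, one row fewer in `M'`,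
`j < c` and `r[j] ≠ 0`. [folklore] -/
theorem splitPivot_eq_some {M : List (List ℕ)} {r : List ℕ} {j : ℕ} {M' : List (List ℕ)}
    (h : splitPivot c M = some (r, j, M')) :
    (∀ x, x ∈ r :: M' ↔ x ∈ M) ∧ M'.length + 1 = M.length ∧ j < c ∧ j < r.length ∧ r.getD j 0 ≠ 0 := by
  induction M generalizing M' with
  | nil => simp [splitPivot] at h
  | cons r₀ M ih =>
    unfold splitPivot at h
    cases hf : firstNZ (r₀.take c) with
    | some j₀ =>
      rw [hf] at h
      simp only [Option.some.injEq, Prod.mk.injEq] at h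
      obtain ⟨rfl, rfl, rfl⟩ := h
      obtain ⟨h1, h2⟩ := firstNZ_eq_some hf
      rw [List.length_take] at h1
      refine ⟨fun x => Iff.rfl, rfl, by omega, by omega, ?_⟩
      rwa [List.getD_eq_getElem?_getD, List.getElem?_take, if_pos (by omega), ← List.getD_eq_getElem?_getD] at h2
    | none =>
      rw [hf] at h
      cases hs : splitPivot c M with
      | none => rw [hs] at h; simp at h
      | some p =>
        rw [hs] at h
        obtain ⟨r₁, j₁, M₁⟩ := p
        simp only [Option.map_some, Option.some.injEq, Prod.mk.injEq] at h
        obtain ⟨rfl, rfl, rfl⟩ := h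
        obtain ⟨hmem, hlen, hjc, hjl, hne⟩ := ih hs
        refine ⟨fun x => ?_, by simp [hlen], hjc, hjl, hne⟩
        simp only [List.mem_cons]
        have := hmem x
        simp only [List.mem_cons] at this
        tauto

end Pivot

/-! ### The peeling loop and the solver -/

variable (N)

/-- One step of the peeling loop on a state `((c, M), ok)`: no pivot ⇒ record `b ≡ 0` for all rows
and finish; otherwise bring the pivot to `(0,0)`, run the rounds, record `gcd(p, N+1) ∣ b₀` and
continue with the other rows, first column deleted. [folklore] -/
def peelStep (F R : ℕ) (st : (ℕ × List (List ℕ)) × Bool) : (ℕ × List (List ℕ)) × Bool :=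
  match splitPivot st.1.1 st.1.2 with
  | none => ((st.1.1, []), st.2 && st.1.2.all fun r => decide (r.getD st.1.1 0 = 0))
  | some (r, j, M') =>
    ((st.1.1 - 1, ((rounds N F st.1.1 R ((r :: M').map (swapCols j))).tail).map List.tail),
      st.2 && decide (((rounds N F st.1.1 R ((r :: M').map (swapCols j))).headD []).getD st.1.1 0 %
        Nat.gcd (((rounds N F st.1.1 R ((r :: M').map (swapCols j))).headD []).getD 0 0) (N + 1) = 0))

/-- **The solver**: `P` peeling steps, then the recorded verdict. [folklore] -/
def solve (F R : ℕ) : ℕ → (ℕ × List (List ℕ)) × Bool → Bool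
  | 0, st => st.2
  | P + 1, st => solve F R P (peelStep N F R st)

variable {N}

/-- Solvability only depends on the set of rows. [folklore] -/
theorem solvable_congr_mem {c : ℕ} {M M' : List (List ℕ)} (h : ∀ x, x ∈ M' ↔ x ∈ M) :
    Solvable N c M' ↔ Solvable N c M :=
  ⟨fun ⟨x, hx⟩ => ⟨x, fun r hr => hx r ((h r).2 hr)⟩, fun ⟨x, hx⟩ => ⟨x, fun r hr => hx r ((h r).1 hr)⟩⟩

/-- **One peeling step is correct**: well-formedness and reducedness are kept, the row count drops
(or the matrix was and stays empty), and `ok ∧ Solvable` is invariant. [folklore] -/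
theorem peelStep_spec {F R : ℕ} (hF : 2 * Nat.size N + 1 ≤ F) (hR : Nat.size N ≤ R) {c : ℕ}
    {M : List (List ℕ)} {ok : Bool} (hwf : WF c M) (hred : Reduced N M) :
    WF (peelStep N F R ((c, M), ok)).1.1 (peelStep N F R ((c, M), ok)).1.2 ∧
    Reduced N (peelStep N F R ((c, M), ok)).1.2 ∧
    ((peelStep N F R ((c, M), ok)).1.2.length < M.length ∨ (M = [] ∧ (peelStep N F R ((c, M), ok)).1.2 = [])) ∧
    (((peelStep N F R ((c, M), ok)).2 = true ∧
        Solvable N (peelStep N F R ((c, M), ok)).1.1 (peelStep N F R ((c, M), ok)).1.2) ↔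
      (ok = true ∧ Solvable N c M)) := by
  unfold peelStep
  dsimp only
  cases hs : splitPivot c M with
  | none =>
    simp only
    have hz := splitPivot_eq_none hs
    refine ⟨fun r hr => by simp at hr, fun r hr => by simp at hr, ?_, ?_⟩
    · cases M with
      | nil => exact Or.inr (by simp)
      | cons r M => exact Or.inl (by simp)
    · have hsolv : Solvable N c ([] : List (List ℕ)) := ⟨fun _ => 0, fun r hr => by simp at hr⟩
      rw [solvable_iff_of_coeffs_zero hz hred]
      simp [hsolv, List.all_eq_true]
  | some p =>
    obtain ⟨r, j, M'⟩ := p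
    simp only
    obtain ⟨hmem, hlen, hjc, hjl, hne⟩ := splitPivot_eq_some hs
    have hc : 1 ≤ c := by omega
    -- transfer to `r :: M'`
    have hwf₀ : WF c (r :: M') := fun x hx => hwf x ((hmem x).1 hx)
    have hred₀ : Reduced N (r :: M') := fun x hx => hred x ((hmem x).1 hx)
    -- the column swap
    set M₁ := (r :: M').map (swapCols j) with hM₁
    have hM₁e : M₁ = swapCols j r :: M'.map (swapCols j) := rfl
    have hwf₁ : WF c M₁ := by
      intro x hx; obtain ⟨x', hx', rfl⟩ := List.mem_map.1 hx; simpa using hwf₀ x' hx'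
    have hred₁ : Reduced N M₁ := by
      intro x hx; obtain ⟨x', hx', rfl⟩ := List.mem_map.1 hx; exact swapCols_lt (hred₀ x' hx')
    have hsol₁ : Solvable N c M₁ ↔ Solvable N c M :=
      (solvable_map_swapCols_iff hwf₀ hjc).trans (solvable_congr_mem hmem)
    have hpos₁ : 0 < (swapCols j r).getD 0 0 := by
      rw [getD_swapCols hjl, Equiv.swap_apply_left]; exact Nat.pos_of_ne_zero hne
    rw [hM₁e] at hwf₁ hred₁ hsol₁
    -- the rounds
    obtain ⟨t', rest', he, hwf', hred', hlen', hsol', _, hclear⟩ :=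
      rounds_clear (N := N) (c := c) hF hR hwf₁ hred₁ hpos₁
    rw [← hM₁e] at he
    rw [he]
    simp only [List.tail_cons, List.headD_cons]
    refine ⟨?_, ?_, ?_, ?_⟩
    · intro x hx
      obtain ⟨x', hx', rfl⟩ := List.mem_map.1 hx
      have := hwf' x' (List.mem_cons_of_mem t' hx')
      rw [List.length_tail, this]; omega
    · intro x hx a ha
      obtain ⟨x', hx', rfl⟩ := List.mem_map.1 hx
      exact hred' x' (List.mem_cons_of_mem t' hx') a (List.mem_of_mem_tail ha)
    · left; rw [List.length_map, hlen', List.length_map]; omega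
    · have key : Solvable N c (t' :: rest') ↔
          (t'.getD c 0 % Nat.gcd (t'.getD 0 0) (N + 1) = 0 ∧ Solvable N (c - 1) (rest'.map List.tail)) := by
        rw [solvable_clear_iff hc hwf' hclear]
        unfold ent
        rw [exists_mul_modEq_iff]
      rw [← hsol₁, ← hsol', key]
      simp only [Bool.and_eq_true, decide_eq_true_eq]
      tauto

/-- On an empty matrix the loop only keeps the verdict. [folklore] -/
theorem solve_nil (F R c : ℕ) (ok : Bool) : ∀ P, solve N F R P ((c, []), ok) = ok := by
  intro P
  induction P with
  | zero => rfl
  | succ P ih =>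
    rw [solve]
    have : peelStep N F R ((c, []), ok) = ((c, []), ok) := by
      unfold peelStep; simp [splitPivot]
    rw [this, ih]

/-- **The solver is correct** on well-formed reduced systems, given enough fuel. [folklore] -/
theorem solve_spec {F R : ℕ} (hF : 2 * Nat.size N + 1 ≤ F) (hR : Nat.size N ≤ R) :
    ∀ (P c : ℕ) (M : List (List ℕ)) (ok : Bool), WF c M → Reduced N M → M.length < P →
      (solve N F R P ((c, M), ok) = true ↔ (ok = true ∧ Solvable N c M)) := by
  intro P
  induction P with
  | zero => intro c M ok _ _ hP; omega
  | succ P ih =>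
    intro c M ok hwf hred hP
    rw [solve]
    obtain ⟨hwf', hred', hlen, hiff⟩ := peelStep_spec (N := N) (ok := ok) hF hR hwf hred
    set st := peelStep N F R ((c, M), ok) with hst
    have est : st = ((st.1.1, st.1.2), st.2) := by simp
    rcases hlen with hlt | ⟨rfl, hnil⟩
    · rw [est, ih st.1.1 st.1.2 st.2 hwf' hred' (by omega)]
      exact hiff
    · rw [est, hnil, solve_nil]
      rw [hnil] at hiff
      have hsolv : Solvable N st.1.1 ([] : List (List ℕ)) := ⟨fun _ => 0, fun r hr => by simp at hr⟩
      simpa [hsolv] using hiff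

/-- **Main theorem.** For a well-formed reduced system `M` in `c` unknowns and fuel
`F ≥ 2 · size N + 1`, `R ≥ size N`, `P > |M|`: `solve N F R P ((c, M), true) = true` iff the system
has a solution modulo `N + 1`. [cite: Schrijver1986, §4.1–§4.4 and §5.3 (method)] -/
theorem solve_eq_true_iff {F R P c : ℕ} {M : List (List ℕ)} (hwf : WF c M) (hred : Reduced N M)
    (hF : 2 * Nat.size N + 1 ≤ F) (hR : Nat.size N ≤ R) (hP : M.length < P) :
    solve N F R P ((c, M), true) = true ↔ Solvable N c M := by
  rw [solve_spec hF hR P c M true hwf hred hP]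
  simp

end ModDiag

end Literature.LinearAlgebra.Matrix
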